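import Summits.QuantumFields.BalabanUV.Beta.GAN24.MixedChannelZeroMode
import Summits.QuantumFields.BalabanUV.Beta.GAN24.T2RecursionAffine

/-!
# `BalabanUV.Beta.GAN24.MixedChannelBondSums` — binder row G-an2-4 / (CONV-C), W-slot, road «W3» (SKELETON-W3 §7.2 / §8.3 (F2)), «W3-ZB*»
# part 4b: THE MIXED CHANNEL IN THE DOUBLE-LEG CURRENCY OF leaf-06's `ExchangeReadout` — the bond sums of the field–field double-leg sums of
# `mixOfK` VANISH (both orientations), and THE MIXED TABLE DROPS OUT OF THE BOND SUM OF THE `W`-TERM of leaf-04's bracket: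
# `Σ_{u′} Σ'_{(y,w)} W2SymOfK K N S M 0 M₂ (κ,u) (κ′,u′) y w f g = ½ · Σ_{u′} Σ'_{(y,w)} [dM (K2OfK … κ′ u′) N S M κ u + dM (K2OfK … κ u) N S M κ′ u′] y w f g`
# (as a `HasSum` identity), generic `K` + the step instances `unitK s_f s_m (KInvStep Lc j)`
# (idle leaf seat `b2b-balaban-gan24-formalise-leaf-14`, gen 23, invitation «W3-ZB*» part 4b; name provisional — the row owner may re-home it)

NOT IN PRINT; OUR BOOKKEEPING.  HONEST FRAMING (cell contract, verbatim): «discharging `BetaPertH` makes Bałaban's UV stability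
UNCONDITIONAL — a real constructive-QFT result; it is NOT the continuum limit and NOT the Clay problem.»  HONEST DEPENDENCY (verbatim):
«continuum YM on T⁴ ⇐ BetaPertH ∧ nine spine estimates (0/9 proved); BetaPertH ⇐ (D1) ∧ (D4) ∧ CAP+tail; G-an2-4 gates asym, D1 and
NE2/3/4.»  [folklore] Fubini bookkeeping and translation re-indexing over TREE objects BY NAME (an2's `SecondOrderResponse.mixOfK` / `W2OfK` /
`W2SymOfK` / `dM` / `K2OfK` / `vertexFamily₂_mixOfK` / `vertexFamily_K2OfK` / `vertexFamily₂_resp` / `mixOfK_translate`, leaf-04's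
`T2RecursionAffine.vertex2OfK_zero`, leaf-06's `KernelLegCharges.summable_prod_of_biLoc` / `tsum_prod_shiftK`, this lineage's
`MultiplierMixedBondSum.hasSum_mixOfK_bond` ((S2c)) and part 4 `MixedChannelZeroMode.biLoc_mixOfK_far` / `shiftK_unitK_KInvStep`); no estimate
about Bałaban's tables, no cited fact, no `def`, no `def … : Prop`, no wall binder; 0 sorry.  Discharges NOTHING of ROW W3-F2a ∕ F2b,
«T2Shape» ∕ «T2SupRate» ∕ (hW, hWall); NOT «W-slot closed», NEVER «G-an2-4 closed»; NOT BetaPertH, NOT continuum, NOT Clay.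

WHY (the located use).  leaf-06's `ExchangeReadout.hasSum_mmRead_K3OfK_unitKStep` reads the ff block of `mmRead Lc (K3OfK K♮ Lc S M W b b′)`
summed over the two coarse points as `−(s_f s_m σ_j)² · (D₁ + D₂ − Σ'_{(y,w)} W b b′ y w (inl α) (inl β))` — «what remains for ROW W3-F2a are
the BOND sums of three ff double-leg sums».  For the W-term of leaf-04's bracket, `W = W2SymOfK K♮ Lc S♮ M♮ 0 M₂♮`
(`T2RecursionAffine.unitS₂_T2Of_succ_affine`), this file settles the MIXED part of that bond sum once and for all:
* §1 `hasSum_tsum_prod_of_bondNull` — a bond family `V u′` bi-localised at one centre with a constant decaying in `|N•u′ − c|₁` and POINTWISE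
  zero bond sum has `HasSum (u′ ↦ Σ'_{(y,w)} V u′ y w f g) 0` (one absolutely convergent family on `Site × (Site × Site)`, two orders).
* §2 `tsum_transpose_eq`, `hasSum_firstBond_of_secondBond` — TRANSPOSITION for a jointly translation-invariant double sequence
  `G (v + t) (w + t) = G v w`: second index summed ↔ first index summed (pure re-indexing; scalar twin of part 4's `inner_tsum_firstBond_eq`).
* §3 **`hasSum_tsum_prod_mixOfK_bond`** (second-bond orientation), `tsum_prod_mixOfK_translate`, **`hasSum_tsum_prod_mixOfK_swap_bond`**
  (first-bond orientation) — generic `K` (decay, zero `colM` bond masses, block covariance), `LocStencilFM` (jointly block-covariant) `M₂`.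
* §4 **`hasSum_tsum_prod_W2SymOfK_sub_resp`** — THE REDUCTION OF THE `W`-TERM: along the bond `u′`,
  `Σ'_{(y,w)} W2SymOfK K N S M 0 M₂ κ u κ′ u′ − ½·(Σ'_{(y,w)} dM (K2OfK K N S M κ′ u′) N S M κ u + Σ'_{(y,w)} dM (K2OfK K N S M κ u) N S M κ′ u′)`
  has `HasSum` ZERO (the `vertex2OfK` of the zero table is `0`; the two mixed terms have zero bond sums; everything else is what it is).
* §5 the STEP INSTANCES for `K := unitK s_f s_m (KInvStep Lc j)`, `N := Lc` (all `K`-hypotheses discharged BY NAME).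
After this file the mixed table `M₂` occurs NOWHERE in what F2a's assembler still has to sum: the `W`-term's bond sum is the
second-response term's, whose field ∕ multiplier split is (Q-lin) ∕ (S3c) ∕ (S2c) business (leaf-02 ∕ leaf-06 currency).
-/

noncomputable section

open Finset
open scoped BigOperators

namespace Summit.QuantumFields.BalabanUV.Beta.GAN24.MixedChannelBondSums

open Literature.MathematicalPhysics.QuantumFieldTheory
open Literature.MathematicalPhysics.QuantumFieldTheory.Balaban1983to89
open Literature.MathematicalPhysics.QuantumFieldTheory.Balaban1983to89.Beta
open AffineAveraging (Site)
open B12Sec2to5 (l1 l1_nonneg)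
open ExpKernelCalculus (MKer Decays BiLoc VertexFamily shiftK Zl summable_exp_shift' l1_sub_symm)
open OneStepResolventKernel (Fib LocStencil biLoc_mono decays_mono)
open OneStepKernelFamily (KInvStep decays_KInvStep colH)
open BalabanStepJets (locStencil_mono)
open SecondOrderResponse (colM dM K2OfK vertex2OfK mixOfK W2OfK W2SymOfK W2OfK_apply LocStencilFM cBi vertexFamily₂_mixOfK
  vertexFamily_K2OfK vertexFamily₂_resp mixOfK_translate)
open Summit.QuantumFields.BalabanUV.Beta.HessKerDressedUnits (unitK decays_unitK)
open Summit.QuantumFields.BalabanUV.Beta.GAN24.KernelLegCharges (summable_prod_of_biLoc tsum_prod_shiftK)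
open Summit.QuantumFields.BalabanUV.Beta.GAN24.MultiplierZeroMass (hasSum_colM_unitK_KInvStep_bond)
open Summit.QuantumFields.BalabanUV.Beta.GAN24.MultiplierMixedBondSum (hasSum_mixOfK_bond)
open Summit.QuantumFields.BalabanUV.Beta.GAN24.MixedChannelZeroMode (biLoc_mixOfK_far shiftK_unitK_KInvStep)
open Summit.QuantumFields.BalabanUV.Beta.GAN24.T2RecursionAffine (vertex2OfK_zero)

variable {d : ℕ}

/-! ## §1 A bond-null, centre-tied family has zero bond sum of its double-leg sums -/

section BondNull

variable {N : ℕ} [NeZero N]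

/-- [folklore] **BOND-NULL + CENTRE-TIED ⟹ THE DOUBLE-LEG SUMS HAVE ZERO BOND SUM.**  If every member `V u′` is bi-localised at one centre `c`
(rate `δv > 0`) with a constant decaying in `|N•u′ − c|₁`, and the bond sum vanishes POINTWISE (`HasSum (u′ ↦ V u′ y w f g) 0`), then
`HasSum (u′ ↦ Σ'_{(y,w)} V u′ y w f g) 0`.  Proof: the family `(u′, (y, w)) ↦ V u′ y w f g` converges absolutely (envelope
`Cv·e^{−δv|N•u′−c|₁}·e^{−δv|y−c|₁}·e^{−δv|w−c|₁}`); summed `u′`-first it vanishes fibrewise, summed `(y, w)`-first its fibres are the double-leg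
sums — `HasSum.prod_fiberwise` in both orders. -/
theorem hasSum_tsum_prod_of_bondNull {V : Site (d + 1) → MKer (d + 1) (Fib d)} {Cv δv : ℝ} {c : Site (d + 1)} (hδv : 0 < δv)
    (hVb : ∀ u', BiLoc (V u') c c (Cv * Real.exp (-δv * l1 ((N : ℤ) • u' - c))) δv)
    (hV0 : ∀ y w f g, HasSum (fun u' : Site (d + 1) => V u' y w f g) 0) (f g : Fib d) :
    HasSum (fun u' : Site (d + 1) => ∑' yw : Site (d + 1) × Site (d + 1), V u' yw.1 yw.2 f g) 0 := by
  have hN : 1 ≤ N := Nat.one_le_iff_ne_zero.2 (NeZero.ne N)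
  have hCv : 0 ≤ Cv := by
    have h := (hVb 0).nonneg (Sum.inl 0)
    exact nonneg_of_mul_nonneg_left h (Real.exp_pos _)
  set G : Site (d + 1) × (Site (d + 1) × Site (d + 1)) → ℝ := fun q => V q.1 q.2.1 q.2.2 f g with hG
  have hGle : ∀ q, |G q| ≤ Cv * (Real.exp (-δv * l1 ((N : ℤ) • q.1 - c)) *
      (Real.exp (-δv * l1 (q.2.1 - c)) * Real.exp (-δv * l1 (q.2.2 - c)))) := by
    intro q
    have h := hVb q.1 q.2.1 q.2.2 f g
    rw [mul_add, Real.exp_add, mul_assoc] at h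
    exact h
  have hmaj : Summable fun q : Site (d + 1) × (Site (d + 1) × Site (d + 1)) =>
      Cv * (Real.exp (-δv * l1 ((N : ℤ) • q.1 - c)) *
        (Real.exp (-δv * l1 (q.2.1 - c)) * Real.exp (-δv * l1 (q.2.2 - c)))) := by
    have h1 := KernelLegCharges.summable_exp_coarse (d := d) hN hδv c
    have h2 := summable_exp_shift' (D := d + 1) hδv c
    have h23 := h2.mul_of_nonneg h2 (fun _ => (Real.exp_pos _).le) (fun _ => (Real.exp_pos _).le)
    exact (h1.mul_of_nonneg h23 (fun _ => (Real.exp_pos _).le)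
      (fun _ => mul_nonneg (Real.exp_pos _).le (Real.exp_pos _).le)).mul_left Cv
  have hGs : Summable G := Summable.of_norm_bounded hmaj (fun q => by rw [Real.norm_eq_abs]; exact hGle q)
  have hfib : ∀ yw : Site (d + 1) × Site (d + 1), HasSum (fun u' : Site (d + 1) => G (u', yw)) 0 :=
    fun yw => hV0 yw.1 yw.2 f g
  have hGs' : Summable fun p : (Site (d + 1) × Site (d + 1)) × Site (d + 1) => G (p.2, p.1) := hGs.prod_symm
  have htot' : ∑' p : (Site (d + 1) × Site (d + 1)) × Site (d + 1), G (p.2, p.1) = 0 :=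
    (hGs'.hasSum.prod_fiberwise hfib).unique hasSum_zero
  have htot : ∑' q, G q = 0 := by
    rw [← htot']
    exact ((Equiv.prodComm (Site (d + 1) × Site (d + 1)) (Site (d + 1))).tsum_eq G).symm
  have h3 := hGs.hasSum.prod_fiberwise fun u' => (hGs.prod_factor u').hasSum
  rw [htot] at h3
  exact h3

end BondNull

/-! ## §2 Transposition of a jointly translation-invariant double sequence -/

/-- [folklore] **TRANSPOSITION** for a double sequence on the lattice with `G (v + t) (w + t) = G v w`: the sum over the SECOND index at any
first index equals the sum over the FIRST index at any second index (both equal `Σ'_w G 0 w`; pure re-indexing, no summability). -/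
theorem tsum_transpose_eq {G : Site (d + 1) → Site (d + 1) → ℝ} (hG : ∀ v w t : Site (d + 1), G (v + t) (w + t) = G v w)
    (u u₀ : Site (d + 1)) : (∑' u', G u u') = ∑' v, G v u₀ := by
  have hL : (∑' u', G u u') = ∑' w, G 0 w := by
    rw [← (Equiv.addRight u).tsum_eq (fun u' => G u u')]
    refine tsum_congr fun w => ?_
    have h := hG 0 w u
    rw [zero_add] at h
    simpa only [Equiv.coe_addRight] using h
  have hR : (∑' v, G v u₀) = ∑' w, G 0 w := by
    rw [← (Equiv.subLeft u₀).tsum_eq (fun v => G v u₀)]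
    refine tsum_congr fun w => ?_
    have h := hG 0 w (u₀ - w)
    rw [zero_add, add_sub_cancel] at h
    simpa only [Equiv.subLeft_apply] using h
  rw [hL, hR]

/-- [folklore] **`HasSum` TRANSPOSITION**: for a jointly translation-invariant double sequence, a `HasSum` along the SECOND index (at one
first index `u₀`) transfers to the same `HasSum` along the FIRST index (at any second index `u`). -/
theorem hasSum_firstBond_of_secondBond {G : Site (d + 1) → Site (d + 1) → ℝ}
    (hG : ∀ v w t : Site (d + 1), G (v + t) (w + t) = G v w) {a : ℝ} (u₀ u : Site (d + 1))
    (h : HasSum (fun w => G u₀ w) a) : HasSum (fun v => G v u) a := by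
  have e1 : (fun w => G u₀ w) = (fun s => G 0 s) ∘ (Equiv.subRight u₀) := by
    funext w
    have h' := hG 0 (w - u₀) u₀
    rw [zero_add, sub_add_cancel] at h'
    simp only [Function.comp_apply, Equiv.subRight_apply]
    exact h'
  have e2 : (fun v => G v u) = (fun s => G 0 s) ∘ (Equiv.subLeft u) := by
    funext v
    have h' := hG 0 (u - v) v
    rw [zero_add, sub_add_cancel] at h'
    simp only [Function.comp_apply, Equiv.subLeft_apply]
    exact h'
  rw [e1, Equiv.hasSum_iff] at h
  rw [e2, Equiv.hasSum_iff]
  exact h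

/-! ## §3 The mixed bi-vertex: zero bond sums of its double-leg sums, both orientations -/

section Mixed

variable {N : ℕ} [NeZero N] {K : MKer (d + 1) (Fib d)} {C m : ℝ}
  {M₂ : Fin (d + 1) → Site (d + 1) → Fin (d + 1) → Site (d + 1) → MKer (d + 1) (Fib d)} {C₂ : ℝ}

/-- [folklore] **(S2c) ⟹ THE DOUBLE-LEG SUMS OF THE MIXED BI-VERTEX HAVE ZERO BOND SUM (second-bond orientation)**: for `K` with
`Decays K C m` (`m > 0`) and zero `colM` bond masses, and a `LocStencilFM` mixed table `M₂` (rate `m`),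
`HasSum (u′ ↦ Σ'_{(y,w)} mixOfK K N M₂ κ u κ′ u′ y w f g) 0` at every first bond `(κ, u)` and every fibre pair `(f, g)`. -/
theorem hasSum_tsum_prod_mixOfK_bond (hK : Decays K C m) (hm : 0 < m)
    (hK0 : ∀ μ ρ w, HasSum (fun y : Site (d + 1) => colM K N μ y ρ w) 0) (hM₂ : LocStencilFM N M₂ C₂ m)
    (κ : Fin (d + 1)) (u : Site (d + 1)) (κ' : Fin (d + 1)) (f g : Fib d) :
    HasSum (fun u' : Site (d + 1) => ∑' yw : Site (d + 1) × Site (d + 1), mixOfK K N M₂ κ u κ' u' yw.1 yw.2 f g) 0 := by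
  have hC : 0 ≤ C := hK.nonneg (Sum.inl 0)
  have hm8 : 0 < m / 8 := by positivity
  have hVb : ∀ u' : Site (d + 1), BiLoc (mixOfK K N M₂ κ u κ' u') ((N : ℤ) • u) ((N : ℤ) • u)
      (cBi d C C₂ m * Real.exp (-(m / 8) * l1 ((N : ℤ) • u' - (N : ℤ) • u))) (m / 8) := by
    intro u'
    have h := biLoc_mixOfK_far hK hC hM₂ hm κ u κ' u'
    rwa [l1_sub_symm] at h
  exact hasSum_tsum_prod_of_bondNull hm8 hVb (fun y w f' g' => hasSum_mixOfK_bond hK hm hK0 hM₂ hm κ u κ' y w f' g') f g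

/-- [folklore] **JOINT TRANSLATION INVARIANCE OF THE MIXED DOUBLE-LEG SUMS**: for a block-covariant kernel and a jointly block-covariant mixed
table, `Σ'_{(y,w)} mixOfK K N M₂ κ (u + t) κ′ (u′ + t) y w f g = Σ'_{(y,w)} mixOfK K N M₂ κ u κ′ u′ y w f g` (`mixOfK_translate` ⨾ `tsum_prod_shiftK`). -/
theorem tsum_prod_mixOfK_translate (hKs : ∀ t, shiftK (-((N : ℤ) • t)) K = K)
    (hM₂t : ∀ (κ : Fin (d + 1)) (u : Site (d + 1)) (ρ : Fin (d + 1)) (w t : Site (d + 1)),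
      M₂ κ (u + (N : ℤ) • t) ρ (w + t) = shiftK (-((N : ℤ) • t)) (M₂ κ u ρ w))
    (κ : Fin (d + 1)) (u : Site (d + 1)) (κ' : Fin (d + 1)) (u' t : Site (d + 1)) (f g : Fib d) :
    (∑' yw : Site (d + 1) × Site (d + 1), mixOfK K N M₂ κ (u + t) κ' (u' + t) yw.1 yw.2 f g)
      = ∑' yw : Site (d + 1) × Site (d + 1), mixOfK K N M₂ κ u κ' u' yw.1 yw.2 f g := by
  rw [mixOfK_translate hKs hM₂t κ u κ' u' t]
  exact tsum_prod_shiftK _ _ f g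

/-- [folklore] **(S2c) ⟹ THE DOUBLE-LEG SUMS OF THE EXCHANGED MIXED BI-VERTEX HAVE ZERO BOND SUM (first-bond orientation)**: under the
hypotheses of `hasSum_tsum_prod_mixOfK_bond` plus block covariance of `K` and joint block covariance of `M₂`,
`HasSum (u′ ↦ Σ'_{(y,w)} mixOfK K N M₂ κ′ u′ κ u y w f g) 0` (the exchanged mixed term of `W2OfK_apply`; §2 transposition). -/
theorem hasSum_tsum_prod_mixOfK_swap_bond (hK : Decays K C m) (hm : 0 < m) (hKs : ∀ t, shiftK (-((N : ℤ) • t)) K = K)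
    (hK0 : ∀ μ ρ w, HasSum (fun y : Site (d + 1) => colM K N μ y ρ w) 0) (hM₂ : LocStencilFM N M₂ C₂ m)
    (hM₂t : ∀ (κ : Fin (d + 1)) (u : Site (d + 1)) (ρ : Fin (d + 1)) (w t : Site (d + 1)),
      M₂ κ (u + (N : ℤ) • t) ρ (w + t) = shiftK (-((N : ℤ) • t)) (M₂ κ u ρ w))
    (κ : Fin (d + 1)) (u : Site (d + 1)) (κ' : Fin (d + 1)) (f g : Fib d) :
    HasSum (fun u' : Site (d + 1) => ∑' yw : Site (d + 1) × Site (d + 1), mixOfK K N M₂ κ' u' κ u yw.1 yw.2 f g) 0 :=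
  hasSum_firstBond_of_secondBond (G := fun v w => ∑' yw : Site (d + 1) × Site (d + 1), mixOfK K N M₂ κ' v κ w yw.1 yw.2 f g)
    (fun v w t => tsum_prod_mixOfK_translate hKs hM₂t κ' v κ w t f g) 0 u
    (hasSum_tsum_prod_mixOfK_bond hK hm hK0 hM₂ κ' 0 κ f g)

/-! ## §4 The mixed table drops out of the bond sum of the `W`-term of the bracket -/

variable {S M : Fin (d + 1) → Site (d + 1) → MKer (d + 1) (Fib d)} {Cs CM : ℝ}

/-- [folklore] **THE `W`-TERM OF leaf-04's BRACKET, SUMMED ALONG THE BOND, IS ITS SECOND-RESPONSE PART.**  For `K` with `Decays K C m`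
(`m > 0`), block covariance and zero `colM` bond masses, first tables `S` (`LocStencil`) and `M` (`VertexFamily`) and a jointly block-covariant
`LocStencilFM` mixed table `M₂` (all at rate `m`): at every first bond `(κ, u)` and fibre pair,
`HasSum (u′ ↦ Σ'_{(y,w)} W2SymOfK K N S M 0 M₂ κ u κ′ u′ y w f g − ½·(Σ'_{(y,w)} dM (K2OfK K N S M κ′ u′) N S M κ u y w f g
 + Σ'_{(y,w)} dM (K2OfK K N S M κ u) N S M κ′ u′ y w f g)) 0` — `W2SymOfK = ½(1 + swap) W2OfK`, `W2OfK … 0 M₂ = 0 + mix + mixˢʷᵃᵖ + dM (K2OfK …)`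
(`W2OfK_apply`, `vertex2OfK_zero`), every piece absolutely summable over the two legs (`vertexFamily₂_mixOfK`, `vertexFamily_K2OfK` ⨾
`vertexFamily₂_resp`), and the two mixed pieces have zero bond sums (§3). -/
theorem hasSum_tsum_prod_W2SymOfK_sub_resp (hK : Decays K C m) (hm : 0 < m) (hKs : ∀ t, shiftK (-((N : ℤ) • t)) K = K)
    (hK0 : ∀ μ ρ w, HasSum (fun y : Site (d + 1) => colM K N μ y ρ w) 0)
    (hS : LocStencil S Cs m) (hM : VertexFamily M N CM m) (hM₂ : LocStencilFM N M₂ C₂ m)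
    (hM₂t : ∀ (κ : Fin (d + 1)) (u : Site (d + 1)) (ρ : Fin (d + 1)) (w t : Site (d + 1)),
      M₂ κ (u + (N : ℤ) • t) ρ (w + t) = shiftK (-((N : ℤ) • t)) (M₂ κ u ρ w))
    (κ : Fin (d + 1)) (u : Site (d + 1)) (κ' : Fin (d + 1)) (f g : Fib d) :
    HasSum (fun u' : Site (d + 1) =>
      (∑' yw : Site (d + 1) × Site (d + 1), W2SymOfK K N S M 0 M₂ κ u κ' u' yw.1 yw.2 f g)
        - (1 / 2 : ℝ) * ((∑' yw : Site (d + 1) × Site (d + 1), dM (K2OfK K N S M κ' u') N S M κ u yw.1 yw.2 f g)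
          + ∑' yw : Site (d + 1) × Site (d + 1), dM (K2OfK K N S M κ u) N S M κ' u' yw.1 yw.2 f g)) 0 := by
  have hC : 0 ≤ C := hK.nonneg (Sum.inl 0)
  have hCs : 0 ≤ Cs := (hS 0 0).nonneg (Sum.inl 0)
  have hCM : 0 ≤ CM := (hM 0 0).nonneg (Sum.inl 0)
  have hm8 : 0 < m / 8 := by positivity
  have hm82 : 0 < m / 8 / 2 := by positivity
  -- localisation of the pieces
  have hmix := vertexFamily₂_mixOfK (N := N) hK hC hM₂ hm
  have hK2 := vertexFamily_K2OfK (N := N) hK hC hm hS hM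
  have hS8 : LocStencil S Cs (m / 8) := locStencil_mono hS hCs (by linarith)
  have hM8 : VertexFamily M N CM (m / 8) := fun μ y => biLoc_mono (hM μ y) hCM (by linarith)
  have hresp := vertexFamily₂_resp hK2 hS8 hM8 hm8
  -- summability of the four pieces over the two legs, at any bond pair
  have s_mix : ∀ (μ : Fin (d + 1)) (y : Site (d + 1)) (ν : Fin (d + 1)) (y' : Site (d + 1)),
      Summable fun yw : Site (d + 1) × Site (d + 1) => mixOfK K N M₂ μ y ν y' yw.1 yw.2 f g :=
    fun μ y ν y' => summable_prod_of_biLoc (hmix μ y ν y') hm8 f g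
  have s_resp : ∀ (μ : Fin (d + 1)) (y : Site (d + 1)) (ν : Fin (d + 1)) (y' : Site (d + 1)),
      Summable fun yw : Site (d + 1) × Site (d + 1) => dM (K2OfK K N S M ν y') N S M μ y yw.1 yw.2 f g :=
    fun μ y ν y' => summable_prod_of_biLoc (hresp μ y ν y') hm82 f g
  -- the bi-vertex of the zero table vanishes
  have hv2 : ∀ (μ : Fin (d + 1)) (y : Site (d + 1)) (ν : Fin (d + 1)) (y' : Site (d + 1)) (x z : Site (d + 1)),
      vertex2OfK K N (0 : Fin (d + 1) → Site (d + 1) → Fin (d + 1) → Site (d + 1) → MKer (d + 1) (Fib d)) μ y ν y' x z f g = 0 := by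
    intro μ y ν y' x z
    rw [vertex2OfK_zero K N μ y ν y']
    rfl
  -- the double-leg sum of `W2OfK … 0 M₂` at any bond pair
  have hW : ∀ (μ : Fin (d + 1)) (y : Site (d + 1)) (ν : Fin (d + 1)) (y' : Site (d + 1)),
      (∑' yw : Site (d + 1) × Site (d + 1), W2OfK K N S M 0 M₂ μ y ν y' yw.1 yw.2 f g)
        = (∑' yw : Site (d + 1) × Site (d + 1), mixOfK K N M₂ μ y ν y' yw.1 yw.2 f g)
          + (∑' yw : Site (d + 1) × Site (d + 1), mixOfK K N M₂ ν y' μ y yw.1 yw.2 f g)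
          + ∑' yw : Site (d + 1) × Site (d + 1), dM (K2OfK K N S M ν y') N S M μ y yw.1 yw.2 f g := by
    intro μ y ν y'
    have e : ∀ yw : Site (d + 1) × Site (d + 1), W2OfK K N S M 0 M₂ μ y ν y' yw.1 yw.2 f g
        = (mixOfK K N M₂ μ y ν y' yw.1 yw.2 f g + mixOfK K N M₂ ν y' μ y yw.1 yw.2 f g)
          + dM (K2OfK K N S M ν y') N S M μ y yw.1 yw.2 f g := by
      intro yw
      rw [W2OfK_apply]
      simp only [Pi.add_apply]
      rw [hv2, zero_add]
    rw [tsum_congr e, ((s_mix μ y ν y').add (s_mix ν y' μ y)).tsum_add (s_resp μ y ν y'),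
      (s_mix μ y ν y').tsum_add (s_mix ν y' μ y)]
  -- the double-leg sum of `W2SymOfK … 0 M₂`
  have hSym : ∀ u' : Site (d + 1),
      (∑' yw : Site (d + 1) × Site (d + 1), W2SymOfK K N S M 0 M₂ κ u κ' u' yw.1 yw.2 f g)
        - (1 / 2 : ℝ) * ((∑' yw : Site (d + 1) × Site (d + 1), dM (K2OfK K N S M κ' u') N S M κ u yw.1 yw.2 f g)
          + ∑' yw : Site (d + 1) × Site (d + 1), dM (K2OfK K N S M κ u) N S M κ' u' yw.1 yw.2 f g)
        = (∑' yw : Site (d + 1) × Site (d + 1), mixOfK K N M₂ κ u κ' u' yw.1 yw.2 f g)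
          + ∑' yw : Site (d + 1) × Site (d + 1), mixOfK K N M₂ κ' u' κ u yw.1 yw.2 f g := by
    intro u'
    have sW : ∀ (μ : Fin (d + 1)) (y : Site (d + 1)) (ν : Fin (d + 1)) (y' : Site (d + 1)),
        Summable fun yw : Site (d + 1) × Site (d + 1) => W2OfK K N S M 0 M₂ μ y ν y' yw.1 yw.2 f g := by
      intro μ y ν y'
      have e : ∀ yw : Site (d + 1) × Site (d + 1), W2OfK K N S M 0 M₂ μ y ν y' yw.1 yw.2 f g
          = (mixOfK K N M₂ μ y ν y' yw.1 yw.2 f g + mixOfK K N M₂ ν y' μ y yw.1 yw.2 f g)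
            + dM (K2OfK K N S M ν y') N S M μ y yw.1 yw.2 f g := by
        intro yw
        rw [W2OfK_apply]
        simp only [Pi.add_apply]
        rw [hv2, zero_add]
      exact (((s_mix μ y ν y').add (s_mix ν y' μ y)).add (s_resp μ y ν y')).congr fun yw => (e yw).symm
    have e : ∀ yw : Site (d + 1) × Site (d + 1), W2SymOfK K N S M 0 M₂ κ u κ' u' yw.1 yw.2 f g
        = (1 / 2 : ℝ) * (W2OfK K N S M 0 M₂ κ u κ' u' yw.1 yw.2 f g + W2OfK K N S M 0 M₂ κ' u' κ u yw.1 yw.2 f g) := by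
      intro yw
      simp only [W2SymOfK, Pi.smul_apply, Pi.add_apply, smul_eq_mul]
    rw [tsum_congr e, tsum_mul_left, (sW κ u κ' u').tsum_add (sW κ' u' κ u), hW κ u κ' u', hW κ' u' κ u]
    ring
  simp_rw [hSym]
  have h := (hasSum_tsum_prod_mixOfK_bond hK hm hK0 hM₂ κ u κ' f g).add
    (hasSum_tsum_prod_mixOfK_swap_bond hK hm hKs hK0 hM₂ hM₂t κ u κ' f g)
  rwa [add_zero] at h

end Mixed

/-! ## §5 The step instances: `K♮_j = unitK s_f s_m (KInvStep Lc j)` at blocking `Lc` -/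

section Step

variable {Lc : ℕ} [NeZero Lc] (sf sm : ℝ) (j : ℕ)
  {M₂ : Fin (d + 1) → Site (d + 1) → Fin (d + 1) → Site (d + 1) → MKer (d + 1) (Fib d)} {C₂ δ₂ : ℝ}
  {S M : Fin (d + 1) → Site (d + 1) → MKer (d + 1) (Fib d)} {Cs δs CM δM : ℝ}

/-- [folklore] **(S2c) ⟹ ZERO BOND SUM OF THE MIXED DOUBLE-LEG SUMS THROUGH THE STEP KERNEL (second-bond orientation)**, every
`LocStencilFM Lc M₂ C₂ δ₂` (`δ₂ > 0`), all units, every `j`, every first bond. -/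
theorem hasSum_tsum_prod_mixOfK_unitKStep_bond (hM₂ : LocStencilFM Lc M₂ C₂ δ₂) (hδ₂ : 0 < δ₂)
    (κ : Fin (d + 1)) (u : Site (d + 1)) (κ' : Fin (d + 1)) (f g : Fib d) :
    HasSum (fun u' : Site (d + 1) => ∑' yw : Site (d + 1) × Site (d + 1),
      mixOfK (unitK sf sm (KInvStep (d := d) Lc j)) Lc M₂ κ u κ' u' yw.1 yw.2 f g) 0 := by
  obtain ⟨δ, C, hδ, hC, hK⟩ := decays_KInvStep (d := d) (Lc := Lc) j
  have hKu := decays_unitK (sf := sf) (sm := sm) hK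
  have hm : 0 < min δ δ₂ := lt_min hδ hδ₂
  have hKu' : Decays (unitK sf sm (KInvStep (d := d) Lc j)) (max |sf| |sm| * C * max |sf| |sm|) (min δ δ₂) :=
    decays_mono hKu (by positivity) le_rfl (min_le_left _ _)
  exact hasSum_tsum_prod_mixOfK_bond hKu' hm (fun μ ρ w => hasSum_colM_unitK_KInvStep_bond (Lc := Lc) sf sm j μ ρ w)
    (hM₂.mono (min_le_right _ _)) κ u κ' f g

/-- [folklore] **(S2c) ⟹ ZERO BOND SUM OF THE EXCHANGED MIXED DOUBLE-LEG SUMS THROUGH THE STEP KERNEL (first-bond orientation)**, for a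
jointly block-covariant `LocStencilFM` table (the `hM₂` shape of `BalabanStepW2.M2Of_translate`). -/
theorem hasSum_tsum_prod_mixOfK_swap_unitKStep_bond (hM₂ : LocStencilFM Lc M₂ C₂ δ₂) (hδ₂ : 0 < δ₂)
    (hM₂t : ∀ (κ : Fin (d + 1)) (u : Site (d + 1)) (ρ : Fin (d + 1)) (w t : Site (d + 1)),
      M₂ κ (u + (Lc : ℤ) • t) ρ (w + t) = shiftK (-((Lc : ℤ) • t)) (M₂ κ u ρ w))
    (κ : Fin (d + 1)) (u : Site (d + 1)) (κ' : Fin (d + 1)) (f g : Fib d) :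
    HasSum (fun u' : Site (d + 1) => ∑' yw : Site (d + 1) × Site (d + 1),
      mixOfK (unitK sf sm (KInvStep (d := d) Lc j)) Lc M₂ κ' u' κ u yw.1 yw.2 f g) 0 := by
  obtain ⟨δ, C, hδ, hC, hK⟩ := decays_KInvStep (d := d) (Lc := Lc) j
  have hKu := decays_unitK (sf := sf) (sm := sm) hK
  have hm : 0 < min δ δ₂ := lt_min hδ hδ₂
  have hKu' : Decays (unitK sf sm (KInvStep (d := d) Lc j)) (max |sf| |sm| * C * max |sf| |sm|) (min δ δ₂) :=
    decays_mono hKu (by positivity) le_rfl (min_le_left _ _)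
  exact hasSum_tsum_prod_mixOfK_swap_bond hKu' hm (shiftK_unitK_KInvStep sf sm j)
    (fun μ ρ w => hasSum_colM_unitK_KInvStep_bond (Lc := Lc) sf sm j μ ρ w) (hM₂.mono (min_le_right _ _)) hM₂t κ u κ' f g

/-- [folklore] **THE `W`-TERM REDUCTION THROUGH THE STEP KERNEL**: for first tables `S` (`LocStencil`, rate `δs > 0`), `M`
(`VertexFamily` at blocking `Lc`, rate `δM > 0`) and a jointly block-covariant `LocStencilFM` mixed table `M₂` (rate `δ₂ > 0`), all units, every `j`,
every first bond `(κ, u)` and fibre pair: the bond sum of the double-leg sums of `W2SymOfK K♮_j Lc S M 0 M₂` is half the bond sum of those of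
`dM (K2OfK K♮_j Lc S M κ′ u′) Lc S M κ u + dM (K2OfK K♮_j Lc S M κ u) Lc S M κ′ u′` (as a `HasSum`-zero identity). -/
theorem hasSum_tsum_prod_W2SymOfK_sub_resp_unitKStep (hS : LocStencil S Cs δs) (hδs : 0 < δs) (hM : VertexFamily M Lc CM δM)
    (hδM : 0 < δM) (hM₂ : LocStencilFM Lc M₂ C₂ δ₂) (hδ₂ : 0 < δ₂)
    (hM₂t : ∀ (κ : Fin (d + 1)) (u : Site (d + 1)) (ρ : Fin (d + 1)) (w t : Site (d + 1)),
      M₂ κ (u + (Lc : ℤ) • t) ρ (w + t) = shiftK (-((Lc : ℤ) • t)) (M₂ κ u ρ w))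
    (κ : Fin (d + 1)) (u : Site (d + 1)) (κ' : Fin (d + 1)) (f g : Fib d) :
    HasSum (fun u' : Site (d + 1) =>
      (∑' yw : Site (d + 1) × Site (d + 1),
          W2SymOfK (unitK sf sm (KInvStep (d := d) Lc j)) Lc S M 0 M₂ κ u κ' u' yw.1 yw.2 f g)
        - (1 / 2 : ℝ) * ((∑' yw : Site (d + 1) × Site (d + 1),
            dM (K2OfK (unitK sf sm (KInvStep (d := d) Lc j)) Lc S M κ' u') Lc S M κ u yw.1 yw.2 f g)
          + ∑' yw : Site (d + 1) × Site (d + 1),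
            dM (K2OfK (unitK sf sm (KInvStep (d := d) Lc j)) Lc S M κ u) Lc S M κ' u' yw.1 yw.2 f g)) 0 := by
  obtain ⟨δ, C, hδ, hC, hK⟩ := decays_KInvStep (d := d) (Lc := Lc) j
  have hKu := decays_unitK (sf := sf) (sm := sm) hK
  have hCs : 0 ≤ Cs := (hS 0 0).nonneg (Sum.inl 0)
  have hCM : 0 ≤ CM := (hM 0 0).nonneg (Sum.inl 0)
  set m : ℝ := min (min (min δ δs) δM) δ₂ with hm_def
  have hm : 0 < m := lt_min (lt_min (lt_min hδ hδs) hδM) hδ₂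
  have hm2 : m ≤ δ₂ := min_le_right _ _
  have hmM : m ≤ δM := (min_le_left _ _).trans (min_le_right _ _)
  have hms : m ≤ δs := (min_le_left _ _).trans ((min_le_left _ _).trans (min_le_right _ _))
  have hmK : m ≤ δ := (min_le_left _ _).trans ((min_le_left _ _).trans (min_le_left _ _))
  have hKu' : Decays (unitK sf sm (KInvStep (d := d) Lc j)) (max |sf| |sm| * C * max |sf| |sm|) m :=
    decays_mono hKu (by positivity) le_rfl hmK
  exact hasSum_tsum_prod_W2SymOfK_sub_resp hKu' hm (shiftK_unitK_KInvStep sf sm j)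
    (fun μ ρ w => hasSum_colM_unitK_KInvStep_bond (Lc := Lc) sf sm j μ ρ w)
    (locStencil_mono hS hCs hms) (fun μ y => biLoc_mono (hM μ y) hCM hmM) (hM₂.mono hm2) hM₂t κ u κ' f g

end Step

end Summit.QuantumFields.BalabanUV.Beta.GAN24.MixedChannelBondSums

end
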